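import Literature.Topology.FourManifolds.CappellShanesonClassGroupFifteen
import Literature.Topology.FourManifolds.CappellShanesonIdealCertificates
import HarnessLib

/-!
# The class group of the trace `18` field (discriminant `56137 = 73 · 769`) and Gompf's conjecture
# for the traces `18` and `-13` (Kim–Yamada 2023, Theorem B)

Serves the named fact
`Literature.Topology.FourManifolds.kimYamada2023_nonempty_diffeomorph_sphere_four_of_trace_mem_Icc`
(`CappellShaneson.lean`; M. H. Kim, S. Yamada, Kyungpook Math. J. 63 (2023) 373–411 =
arXiv:1707.03860, Cor. C), reduced in the tree to Gompf's topological leaves and Theorem B in matrix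
form (`GompfConjectureForTrace n`) for the traces not yet proved. Like its siblings for the traces
`12`, `14`–`17`, this file PROVES Theorem B for the trace `18` — `C(ℤ[Θ₁₈])` is covered by the
representatives `(1, 1, 18)`, `(3, 5, 18)`, the latter moving by Gompf moves to the trace
`8 = 18 - 2·5` (Lemma 6.1 / §6.1), where Gompf's conjecture holds (class number one) — and, by
Theorem A, for `-13 = 5 - 18`.

## The number theory

For a cubic number field `K` generated by a root `θ` of `f₁₈ = x³ - 18x² + 17x - 1`:

* `Δ(f₁₈) = 56137 = 73 · 769` is squarefree, so `𝓞 K = ℤ[θ]`, `d_K = 56137`, `⌊M_K⌋ ≤ 67`;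
* Dedekind–Kummer at `p ≤ 67` (Marcus, Ch. 3, Thm. 27): `2, 3, 7, 11, 13, 19, 29, 41, 53, 59` are
  inert; `f₁₈ ≡ (x - 3)(x² + 2) (mod 5)` (linear times irreducible quadratic); unique roots
  `3, 21, 2, 36, 30, 31, 18, 20` modulo `17, 23, 31, 37, 43, 47, 61, 67`;
* relations with explicit cofactors: `𝔭₅² = (2θ - 1)`, `𝔭₅ 𝔮₂₅ = (5)`, `𝔭₅ 𝔭₁₇ = (θ - 3)`, `𝔭₅ 𝔭₂₃ = (θ + 2)`, `𝔭₃₁ = (θ - 2)`, `𝔭₃₇ = (θ + 1)`, `𝔭₅ 𝔭₄₃ = (3θ - 4)`, `𝔭₅ 𝔭₄₇ = (3θ + 1)`, `𝔭₅ 𝔭₆₁ = (θ - 18)`, `𝔭₆₁ 𝔭₆₇ = (3θ + 7)` (norms `25, 125, 85, 115, 31, 37, 215, 235, 305, 4087`);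
* hence every ideal class is `1` or `[𝔭₅]`, `[𝔭₅]² = 1` (`classGroup_mem_pair_eighteen`).

Transport to `ℤ[X]/(f₁₈)` and Prop. 2.14 (`exists_isConj_standardCSMatrix_of_cover`):
`isConj_standardCSMatrix_of_trace_eq_eighteen`, `gompfConjectureForTrace_eighteen`,
`gompfConjectureForTrace_neg_thirteen`. No named fact is introduced (D-0026).

## References

* [KimYamada2023] M. H. Kim, S. Yamada, Kyungpook Math. J. 63 (2023) 373–411 (arXiv:1707.03860):
  §2.3 (Prop. 2.14), §5 (Table 2), §6.1 (Lemma 6.1 and the proof of Thm. B), Thm. A.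
* [Marcus2018] D. A. Marcus, *Number Fields*, 2nd ed., Ch. 3, Thm. 27 (Dedekind–Kummer); Ch. 5,
  Cor. 2 of Thm. 37 (Minkowski bound).
-/

noncomputable section

open Set Polynomial Module NumberField Ideal
open scoped NumberField MatrixGroups nonZeroDivisors
open Literature.LinearAlgebra.Matrix

namespace Literature.Topology.FourManifolds


section Field

variable {K : Type*} [Field K] [NumberField K] {θ : K}

/-! ### Discriminant `56137` and `𝓞 K = ℤ[θ]` -/

/-- `Δ(f₁₈) = 18·16·15·13 - 23 = 56137`. [cite: KimYamada2023, §3 (Δ(fₙ) = n(n-2)(n-3)(n-5) - 23)] -/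
theorem csDisc_eighteen : csDisc 18 = 56137 := by
  decide

set_option maxRecDepth 8192 in
/-- `56137 = 73 · 769` is squarefree, so `Δ(f₁₈)` has no factorisation `r² e` with `|e| > 2`,
`r ≠ ±1`, and `𝓞 K = ℤ[θ]`. [folklore] -/
theorem csDisc_eighteen_sq : ∀ r e : ℤ, csDisc 18 = r ^ 2 * e → 2 < |e| → IsUnit r :=
  isUnit_of_eq_sq_mul (B := 236) (by decide) (by decide) (by decide)

/-- `d_K = 56137` for the trace `18` field. [folklore] -/
theorem discr_eq_eighteen (hθ : aeval θ (csPoly 18) = 0) (h3 : finrank ℚ K = 3) :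
    NumberField.discr K = 56137 := by
  rw [discr_eq_csDisc_of_sq hθ h3 csDisc_eighteen_sq, csDisc_eighteen]

/-- The cubic relation `θ³ - 18θ² + 17θ - 1 = 0` in `𝓞 K`. [folklore] -/
theorem thetaInt_rel_eighteen (hθ : aeval θ (csPoly 18) = 0) :
    (thetaInt hθ) ^ 3 - 18 * (thetaInt hθ) ^ 2 + 17 * thetaInt hθ - 1 = 0 := by
  have rel := thetaInt_rel hθ
  push_cast at rel
  linear_combination rel

/-! ### The primes of norm at most `67` (Dedekind–Kummer) -/

set_option maxRecDepth 16384 in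
/-- The inert primes `2, 3, 7, 11, 13, 19, 29, 41, 53, 59` (no root of `f₁₈`): every prime above them is `(p)`. [folklore] -/
theorem eq_span_of_inert_eighteen (hθ : aeval θ (csPoly 18) = 0) (h3 : finrank ℚ K = 3) {p : ℕ}
    (hp : p = 2 ∨ p = 3 ∨ p = 7 ∨ p = 11 ∨ p = 13 ∨ p = 19 ∨ p = 29 ∨ p = 41 ∨ p = 53 ∨ p = 59)
    {P : Ideal (𝓞 K)} (hP : P ∈ primesOver (span {(p : ℤ)}) (𝓞 K)) : P = span {(p : 𝓞 K)} := by
  rcases hp with rfl | rfl | rfl | rfl | rfl | rfl | rfl | rfl | rfl | rfl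
  · exact eq_span_of_no_root_of_sq hθ h3 csDisc_eighteen_sq (by norm_num) hP (by decide)
  · exact eq_span_of_no_root_of_sq hθ h3 csDisc_eighteen_sq (by norm_num) hP (by decide)
  · exact eq_span_of_no_root_of_sq hθ h3 csDisc_eighteen_sq (by norm_num) hP (by decide)
  · exact eq_span_of_no_root_of_sq hθ h3 csDisc_eighteen_sq (by norm_num) hP (by decide)
  · exact eq_span_of_no_root_of_sq hθ h3 csDisc_eighteen_sq (by norm_num) hP (by decide)
  · exact eq_span_of_no_root_of_sq hθ h3 csDisc_eighteen_sq (by norm_num) hP (by decide)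
  · exact eq_span_of_no_root_of_sq hθ h3 csDisc_eighteen_sq (by norm_num) hP (by decide)
  · exact eq_span_of_no_root_of_sq hθ h3 csDisc_eighteen_sq (by norm_num) hP (by decide)
  · exact eq_span_of_no_root_of_sq hθ h3 csDisc_eighteen_sq (by norm_num) hP (by decide)
  · exact eq_span_of_no_root_of_sq hθ h3 csDisc_eighteen_sq (by norm_num) hP (by decide)

set_option maxRecDepth 16384 in
/-- The degree-one primes at primes with a unique root of `f₁₈`: `(17, θ - 3)`, `(23, θ - 21)`, `(31, θ - 2)`, `(37, θ - 36)`, `(43, θ - 30)`, `(47, θ - 31)`, `(61, θ - 18)`, `(67, θ - 20)` are the only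
primes `P` above them with `p ^ {f_P} ≤ 67`. [folklore] -/
theorem eq_span_pair_of_unique_root_eighteen (hθ : aeval θ (csPoly 18) = 0) (h3 : finrank ℚ K = 3)
    {p : ℕ} {c₀ : ℤ}
    (hp : (p = 17 ∧ c₀ = 3) ∨ (p = 23 ∧ c₀ = 21) ∨ (p = 31 ∧ c₀ = 2) ∨ (p = 37 ∧ c₀ = 36) ∨ (p = 43 ∧ c₀ = 30) ∨ (p = 47 ∧ c₀ = 31) ∨ (p = 61 ∧ c₀ = 18) ∨ (p = 67 ∧ c₀ = 20))
    {P : Ideal (𝓞 K)} (hP : P ∈ primesOver (span {(p : ℤ)}) (𝓞 K)) (hle : p ^ P.inertiaDeg ℤ ≤ 67) :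
    P = span {(p : 𝓞 K), thetaInt hθ - (c₀ : 𝓞 K)} := by
  rcases hp with ⟨rfl, rfl⟩ | ⟨rfl, rfl⟩ | ⟨rfl, rfl⟩ | ⟨rfl, rfl⟩ | ⟨rfl, rfl⟩ | ⟨rfl, rfl⟩ | ⟨rfl, rfl⟩ | ⟨rfl, rfl⟩
  · exact eq_span_pair_of_unique_root_of_sq hθ h3 csDisc_eighteen_sq (by norm_num) hP hle
      (by decide) (by norm_num)
  · exact eq_span_pair_of_unique_root_of_sq hθ h3 csDisc_eighteen_sq (by norm_num) hP hle
      (by decide) (by norm_num)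
  · exact eq_span_pair_of_unique_root_of_sq hθ h3 csDisc_eighteen_sq (by norm_num) hP hle
      (by decide) (by norm_num)
  · exact eq_span_pair_of_unique_root_of_sq hθ h3 csDisc_eighteen_sq (by norm_num) hP hle
      (by decide) (by norm_num)
  · exact eq_span_pair_of_unique_root_of_sq hθ h3 csDisc_eighteen_sq (by norm_num) hP hle
      (by decide) (by norm_num)
  · exact eq_span_pair_of_unique_root_of_sq hθ h3 csDisc_eighteen_sq (by norm_num) hP hle
      (by decide) (by norm_num)
  · exact eq_span_pair_of_unique_root_of_sq hθ h3 csDisc_eighteen_sq (by norm_num) hP hle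
      (by decide) (by norm_num)
  · exact eq_span_pair_of_unique_root_of_sq hθ h3 csDisc_eighteen_sq (by norm_num) hP hle
      (by decide) (by norm_num)

/-- `f₁₈ = (x - 3)(x^2 + 2) + 5(-3 * x^2 + 3 * x + 1)`: the factorisation modulo `5`. [folklore] -/
theorem csPoly_eighteen_eq_five :
    csPoly 18 = (X - 3) * (X ^ 2 + 2) + 5 * (-3 * X ^ 2 + 3 * X + 1) := by
  simp only [csPoly, map_sub, map_one, map_ofNat]
  ring

set_option linter.unusedSimpArgs false in
/-- The lift `X ^ 2 + 2` reduces modulo `5` to the same expression in `𝔽₅[x]`. [folklore] -/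
theorem map_quad_eighteen_five :
    (X ^ 2 + 2 : ℤ[X]).map (Int.castRingHom (ZMod 5)) = X ^ 2 + 2 := by
  simp only [Polynomial.map_add, Polynomial.map_sub, Polynomial.map_neg, Polynomial.map_mul, Polynomial.map_pow,
    map_X, Polynomial.map_ofNat, Polynomial.map_one]

set_option linter.unusedSimpArgs false in
/-- `f₁₈ mod 5 = (x - 3)·(X ^ 2 + 2)`. [folklore] -/
theorem csPolyMod_eighteen_five :
    csPolyMod 18 5 = (X - C ((3 : ℤ) : ZMod 5)) *
      (X ^ 2 + 2 : ℤ[X]).map (Int.castRingHom (ZMod 5)) := by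
  rw [csPolyMod, csPoly_eighteen_eq_five, Polynomial.map_add]
  have hp : Polynomial.map (Int.castRingHom (ZMod 5)) (5 * (-3 * X ^ 2 + 3 * X + 1) : ℤ[X]) = 0 := by
    rw [Polynomial.map_mul, show (5 : ℤ[X]) = C 5 from rfl, Polynomial.map_C]
    have : (Int.castRingHom (ZMod 5)) 5 = 0 := by decide
    rw [this, C_0, zero_mul]
  rw [hp, add_zero, map_quad_eighteen_five]
  simp only [Polynomial.map_mul, Polynomial.map_sub, Polynomial.map_add, Polynomial.map_neg, Polynomial.map_pow,
    map_X, Polynomial.map_ofNat, Polynomial.map_one, Int.cast_ofNat, map_ofNat]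

/-- `X ^ 2 + 2` is monic over `𝔽₅`. [folklore] -/
theorem monic_quad_eighteen_five :
    ((X ^ 2 + 2 : ℤ[X]).map (Int.castRingHom (ZMod 5))).Monic := by
  rw [map_quad_eighteen_five]
  monicity!

/-- `X ^ 2 + 2` has no root modulo `5`. [folklore] -/
theorem quad_eighteen_five_ne_zero : ∀ c : ZMod 5, c ^ 2 + 2 ≠ 0 := by
  decide

/-- `X ^ 2 + 2` is irreducible over `𝔽₅`. [folklore] -/
theorem irreducible_quad_eighteen_five :
    Irreducible ((X ^ 2 + 2 : ℤ[X]).map (Int.castRingHom (ZMod 5))) := by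
  haveI := Fact.mk (show Nat.Prime 5 by norm_num)
  rw [map_quad_eighteen_five]
  have hdeg : (X ^ 2 + 2 : (ZMod 5)[X]).natDegree = 2 := by compute_degree!
  refine irreducible_of_degree_le_three_of_not_isRoot (by rw [hdeg]; decide) fun c hc =>
    quad_eighteen_five_ne_zero c ?_
  have h := hc
  rw [IsRoot.def] at h
  simpa using h

set_option linter.unusedSimpArgs false in
/-- **The primes above `5`**: `(5, θ - 3)` (degree one) and `(5, θ ^ 2 + 2)` (degree two). [folklore] -/
theorem eq_P5_or_eq_Q5_eighteen (hθ : aeval θ (csPoly 18) = 0) (h3 : finrank ℚ K = 3)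
    {P : Ideal (𝓞 K)} (hP : P ∈ primesOver (span {((5 : ℕ) : ℤ)}) (𝓞 K)) :
    P = span {(5 : 𝓞 K), thetaInt hθ - 3} ∨
      P = span {(5 : 𝓞 K), thetaInt hθ ^ 2 + 2} := by
  rcases eq_span_pair_of_linear_mul_quadratic_of_sq hθ h3 csDisc_eighteen_sq (by norm_num)
    monic_quad_eighteen_five irreducible_quad_eighteen_five csPolyMod_eighteen_five hP with h | h
  · left; simpa using h
  · right
    simp only [map_add, map_sub, map_neg, map_mul, map_pow, aeval_X, map_ofNat, map_one] at h
    simpa using h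

/-! ### Relations among the small primes: explicit generators -/

/-- **`𝔭₅² = (2θ - 1)`** (`N(2θ - 1) = -25`). In particular `[𝔭₅]² = 1`. [folklore] -/
theorem P5_mul_P5_eighteen (hθ : aeval θ (csPoly 18) = 0) :
    span {(5 : 𝓞 K), thetaInt hθ - 3} * span {(5 : 𝓞 K), thetaInt hθ - 3} =
      span {2 * thetaInt hθ - 1} := by
  have rel := thetaInt_rel_eighteen hθ
  set t := thetaInt hθ with ht
  exact span_pair_mul_span_pair_eq_span_singleton
    (δ₁ := -4 * t ^ 2 + 70 * t - 33) (δ₂ := 2 * t ^ 2 - 35 * t + 19)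
    (δ₃ := 2 * t ^ 2 - 35 * t + 19) (δ₄ := -t ^ 2 + 18 * t - 11)
    (u₁ := -54 * t ^ 2) (u₂ := -72 * t + 6) (u₃ := 0) (u₄ := 143 * t - 6)
    (by linear_combination (8 : 𝓞 K) * rel) (by linear_combination (-4 : 𝓞 K) * rel)
    (by linear_combination (-4 : 𝓞 K) * rel) (by linear_combination (2 : 𝓞 K) * rel)
    (by linear_combination (-143 : 𝓞 K) * rel)

/-- **`𝔭₅ 𝔮₂₅ = (5)`**, `𝔮₂₅ = (5, θ² + 2)` the prime of degree two above `5` (`f₁₈ ≡ (x - 3)(x² + 2) (mod 5)`). [folklore] -/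
theorem P5_mul_Q5_eighteen (hθ : aeval θ (csPoly 18) = 0) :
    span {(5 : 𝓞 K), thetaInt hθ - 3} * span {(5 : 𝓞 K), thetaInt hθ ^ 2 + 2} =
      span {5} := by
  have rel := thetaInt_rel_eighteen hθ
  set t := thetaInt hθ with ht
  exact span_pair_mul_span_pair_eq_span_singleton
    (δ₁ := 5) (δ₂ := t ^ 2 + 2)
    (δ₃ := t - 3) (δ₄ := 3 * t ^ 2 - 3 * t - 1)
    (u₁ := -3) (u₂ := 3) (u₃ := -3) (u₄ := -1)
    (by ring) (by ring)
    (by ring) (by linear_combination (1 : 𝓞 K) * rel)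
    (by linear_combination (1 : 𝓞 K) * rel)

/-- **`𝔭₅ 𝔭₁₇ = (θ - 3)`** (`N = 85`). [folklore] -/
theorem P5_mul_P17_eighteen (hθ : aeval θ (csPoly 18) = 0) :
    span {(5 : 𝓞 K), thetaInt hθ - 3} * span {(17 : 𝓞 K), thetaInt hθ - 3} =
      span {thetaInt hθ - 3} := by
  have rel := thetaInt_rel_eighteen hθ
  set t := thetaInt hθ with ht
  exact span_pair_mul_span_pair_eq_span_singleton
    (δ₁ := t ^ 2 - 15 * t - 28) (δ₂ := 5)
    (δ₃ := 17) (δ₄ := t - 3)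
    (u₁ := 0) (u₂ := 7) (u₃ := -2) (u₄ := 0)
    (by linear_combination (-1 : 𝓞 K) * rel) (by ring)
    (by ring) (by ring)
    (by ring)

/-- **`𝔭₅ 𝔭₂₃ = (θ + 2)`** (`N = 115`). [folklore] -/
theorem P5_mul_P23_eighteen (hθ : aeval θ (csPoly 18) = 0) :
    span {(5 : 𝓞 K), thetaInt hθ - 3} * span {(23 : 𝓞 K), thetaInt hθ - 21} =
      span {thetaInt hθ + 2} := by
  have rel := thetaInt_rel_eighteen hθ
  set t := thetaInt hθ with ht
  exact span_pair_mul_span_pair_eq_span_singleton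
    (δ₁ := t ^ 2 - 20 * t + 57) (δ₂ := -t ^ 2 + 20 * t - 52)
    (δ₃ := -t ^ 2 + 20 * t - 34) (δ₄ := t ^ 2 - 19 * t + 31)
    (u₁ := -7) (u₂ := -9) (u₃ := 2) (u₄ := 0)
    (by linear_combination (-1 : 𝓞 K) * rel) (by linear_combination (1 : 𝓞 K) * rel)
    (by linear_combination (1 : 𝓞 K) * rel) (by linear_combination (-1 : 𝓞 K) * rel)
    (by ring)

/-- **`𝔭₃₁ = (31, θ - 2) = (θ - 2)` is principal** (`N(θ - 2) = 31`). [folklore] -/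
theorem P31_eq_eighteen (hθ : aeval θ (csPoly 18) = 0) :
    span {(31 : 𝓞 K), thetaInt hθ - 2} = span {thetaInt hθ - 2} := by
  have rel := thetaInt_rel_eighteen hθ
  set t := thetaInt hθ with ht
  exact span_pair_eq_span_singleton (u := 0) (v := 1) (δ := t ^ 2 - 16 * t - 15)
    (ε := 1)
    (by ring) (by linear_combination (-1 : 𝓞 K) * rel) (by ring)

/-- **`𝔭₃₇ = (37, θ - 36) = (θ + 1)` is principal** (`N(θ + 1) = 37`). [folklore] -/
theorem P37_eq_eighteen (hθ : aeval θ (csPoly 18) = 0) :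
    span {(37 : 𝓞 K), thetaInt hθ - 36} = span {thetaInt hθ + 1} := by
  have rel := thetaInt_rel_eighteen hθ
  set t := thetaInt hθ with ht
  exact span_pair_eq_span_singleton (u := 1) (v := 1) (δ := t ^ 2 - 19 * t + 36)
    (ε := -t ^ 2 + 19 * t - 35)
    (by ring) (by linear_combination (-1 : 𝓞 K) * rel) (by linear_combination (1 : 𝓞 K) * rel)

/-- **`𝔭₅ 𝔭₄₃ = (3θ - 4)`** (`N = 215`). [folklore] -/
theorem P5_mul_P43_eighteen (hθ : aeval θ (csPoly 18) = 0) :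
    span {(5 : 𝓞 K), thetaInt hθ - 3} * span {(43 : 𝓞 K), thetaInt hθ - 30} =
      span {3 * thetaInt hθ - 4} := by
  have rel := thetaInt_rel_eighteen hθ
  set t := thetaInt hθ with ht
  exact span_pair_mul_span_pair_eq_span_singleton
    (δ₁ := 9 * t ^ 2 - 150 * t - 47) (δ₂ := -6 * t ^ 2 + 100 * t + 33)
    (δ₃ := -3 * t ^ 2 + 50 * t + 30) (δ₄ := 2 * t ^ 2 - 33 * t - 21)
    (u₁ := -5) (u₂ := -8) (u₃ := 1) (u₄ := 0)
    (by linear_combination (-27 : 𝓞 K) * rel) (by linear_combination (18 : 𝓞 K) * rel)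
    (by linear_combination (9 : 𝓞 K) * rel) (by linear_combination (-6 : 𝓞 K) * rel)
    (by ring)

/-- **`𝔭₅ 𝔭₄₇ = (3θ + 1)`** (`N = 235`). [folklore] -/
theorem P5_mul_P47_eighteen (hθ : aeval θ (csPoly 18) = 0) :
    span {(5 : 𝓞 K), thetaInt hθ - 3} * span {(47 : 𝓞 K), thetaInt hθ - 31} =
      span {3 * thetaInt hθ + 1} := by
  have rel := thetaInt_rel_eighteen hθ
  set t := thetaInt hθ with ht
  exact span_pair_mul_span_pair_eq_span_singleton
    (δ₁ := 9 * t ^ 2 - 165 * t + 208) (δ₂ := -6 * t ^ 2 + 110 * t - 137)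
    (δ₃ := -6 * t ^ 2 + 110 * t - 123) (δ₄ := 4 * t ^ 2 - 73 * t + 81)
    (u₁ := 6) (u₂ := 10) (u₃ := -1) (u₄ := 0)
    (by linear_combination (-27 : 𝓞 K) * rel) (by linear_combination (18 : 𝓞 K) * rel)
    (by linear_combination (18 : 𝓞 K) * rel) (by linear_combination (-12 : 𝓞 K) * rel)
    (by ring)

/-- **`𝔭₅ 𝔭₆₁ = (θ - 18)`** (`N = -305`). [folklore] -/
theorem P5_mul_P61_eighteen (hθ : aeval θ (csPoly 18) = 0) :
    span {(5 : 𝓞 K), thetaInt hθ - 3} * span {(61 : 𝓞 K), thetaInt hθ - 18} =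
      span {thetaInt hθ - 18} := by
  have rel := thetaInt_rel_eighteen hθ
  set t := thetaInt hθ with ht
  exact span_pair_mul_span_pair_eq_span_singleton
    (δ₁ := -t ^ 2 - 17) (δ₂ := 5)
    (δ₃ := -3 * t ^ 2 + 10) (δ₄ := t - 3)
    (u₁ := -3) (u₂ := -12) (u₃ := 1) (u₄ := 0)
    (by linear_combination (1 : 𝓞 K) * rel) (by ring)
    (by linear_combination (3 : 𝓞 K) * rel) (by ring)
    (by ring)

/-- **`𝔭₆₁ 𝔭₆₇ = (3θ + 7)`** (`N = 4087 = 61 · 67`). [folklore] -/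
theorem P61_mul_P67_eighteen (hθ : aeval θ (csPoly 18) = 0) :
    span {(61 : 𝓞 K), thetaInt hθ - 18} * span {(67 : 𝓞 K), thetaInt hθ - 20} =
      span {3 * thetaInt hθ + 7} := by
  have rel := thetaInt_rel_eighteen hθ
  set t := thetaInt hθ with ht
  exact span_pair_mul_span_pair_eq_span_singleton
    (δ₁ := 9 * t ^ 2 - 183 * t + 580) (δ₂ := -3 * t ^ 2 + 61 * t - 173)
    (δ₃ := -3 * t ^ 2 + 61 * t - 171) (δ₄ := t ^ 2 - 20 * t + 51)
    (u₁ := 1) (u₂ := 33) (u₃ := -30) (u₄ := 0)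
    (by linear_combination (-27 : 𝓞 K) * rel) (by linear_combination (9 : 𝓞 K) * rel)
    (by linear_combination (9 : 𝓞 K) * rel) (by linear_combination (-3 : 𝓞 K) * rel)
    (by ring)


/-! ### Every ideal class is `1` or `[𝔭₅]` -/

/-- `𝔭₅ = (5, θ - 3)` is a nonzero ideal. [folklore] -/
theorem P5_mem_nonZeroDivisors_eighteen (hθ : aeval θ (csPoly 18) = 0) :
    span {(5 : 𝓞 K), thetaInt hθ - 3} ∈ (Ideal (𝓞 K))⁰ := by
  have h := span_pair_natCast_mem_nonZeroDivisors (K := K) (n := 5) (Nat.succ_ne_zero 4)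
    (thetaInt hθ - 3)
  simp only [Nat.cast_ofNat] at h
  exact h

/-- **Every ideal class of the trace `18` field is `1` or `[𝔭₅]`, and `[𝔭₅]² = 1`** (class number
`≤ 2`). Proof: `d_K = 56137`, `⌊M_K⌋ ≤ 67`; Dedekind–Kummer at `p ≤ 67` and the relations `𝔭₅² = (2θ - 1)`, `𝔭₅ 𝔮₂₅ = (5)`, `𝔭₅ 𝔭₁₇ = (θ - 3)`, `𝔭₅ 𝔭₂₃ = (θ + 2)`, `𝔭₃₁ = (θ - 2)`, `𝔭₃₇ = (θ + 1)`, `𝔭₅ 𝔭₄₃ = (3θ - 4)`, `𝔭₅ 𝔭₄₇ = (3θ + 1)`, `𝔭₅ 𝔭₆₁ = (θ - 18)`, `𝔭₆₁ 𝔭₆₇ = (3θ + 7)`. [cite: KimYamada2023, §6.1 (proof of Thm. B)] -/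
theorem classGroup_mem_pair_eighteen (hθ : aeval θ (csPoly 18) = 0) (h3 : finrank ℚ K = 3)
    (C : ClassGroup (𝓞 K)) :
    C = 1 ∨ C = ClassGroup.mk0 ⟨span {(5 : 𝓞 K), thetaInt hθ - 3}, P5_mem_nonZeroDivisors_eighteen hθ⟩ := by
  classical
  set cg : ClassGroup (𝓞 K) :=
    ClassGroup.mk0 ⟨span {(5 : 𝓞 K), thetaInt hθ - 3}, P5_mem_nonZeroDivisors_eighteen hθ⟩ with hcg
  have rel := thetaInt_rel_eighteen hθ
  set t := thetaInt hθ with ht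
  have hne : ∀ (x y : 𝓞 K) (n : ℕ), x * y = n → n ≠ 0 → x ≠ 0 := by
    rintro x y n hxy hn rfl
    rw [zero_mul] at hxy
    exact hn (by exact_mod_cast hxy.symm)
  have hne1 : 2 * t - 1 ≠ 0 :=
    hne _ (-4 * t ^ 2 + 70 * t - 33) 25 (by push_cast; linear_combination (-8 : 𝓞 K) * rel)
      (by norm_num)
  have hne2 : t - 3 ≠ 0 :=
    hne _ (t ^ 2 - 15 * t - 28) 85 (by push_cast; linear_combination (1 : 𝓞 K) * rel)
      (by norm_num)
  have hne3 : t + 2 ≠ 0 :=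
    hne _ (t ^ 2 - 20 * t + 57) 115 (by push_cast; linear_combination (1 : 𝓞 K) * rel)
      (by norm_num)
  have hne4 : 3 * t - 4 ≠ 0 :=
    hne _ (9 * t ^ 2 - 150 * t - 47) 215 (by push_cast; linear_combination (27 : 𝓞 K) * rel)
      (by norm_num)
  have hne5 : 3 * t + 1 ≠ 0 :=
    hne _ (9 * t ^ 2 - 165 * t + 208) 235 (by push_cast; linear_combination (27 : 𝓞 K) * rel)
      (by norm_num)
  have hne6 : t - 18 ≠ 0 :=
    hne _ (-t ^ 2 - 17) 305 (by push_cast; linear_combination (-1 : 𝓞 K) * rel)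
      (by norm_num)
  have hne7 : 3 * t + 7 ≠ 0 :=
    hne _ (9 * t ^ 2 - 183 * t + 580) 4087 (by push_cast; linear_combination (27 : 𝓞 K) * rel)
      (by norm_num)
  have hsq : cg * cg = 1 := by
    have h : cg = cg⁻¹ :=
      ClassGroup.mk0_eq_mk0_inv_iff.mpr ⟨_, hne1, by simpa using P5_mul_P5_eighteen hθ⟩
    rwa [eq_inv_iff_mul_eq_one] at h
  let H : Subgroup (ClassGroup (𝓞 K)) := Subgroup.zpowers cg
  have hcgH : cg ∈ H := Subgroup.mem_zpowers cg
  have hinv : ∀ (P Q : Ideal (𝓞 K)) (hP0 : P ∈ (Ideal (𝓞 K))⁰) (hQ0 : Q ∈ (Ideal (𝓞 K))⁰) (x : 𝓞 K),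
      x ≠ 0 → P * Q = span {x} → ClassGroup.mk0 ⟨P, hP0⟩ = (ClassGroup.mk0 ⟨Q, hQ0⟩)⁻¹ := by
    intro P Q hP0 hQ0 x hx hPQ
    exact ClassGroup.mk0_eq_mk0_inv_iff.mpr ⟨x, hx, by simpa using hPQ⟩
  have hprinc : ∀ (P : Ideal (𝓞 K)) (hP0 : P ∈ (Ideal (𝓞 K))⁰) (x : 𝓞 K), P = span {x} →
      ClassGroup.mk0 ⟨P, hP0⟩ ∈ H := by
    intro P hP0 x hPx
    have : ClassGroup.mk0 ⟨P, hP0⟩ = 1 :=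
      (ClassGroup.mk0_eq_one_iff hP0).mpr ⟨⟨x, by rw [hPx, submodule_span_eq]⟩⟩
    rw [this]
    exact H.one_mem
  have hnz : ∀ (n : ℕ) (hn : n ≠ 0) (x : 𝓞 K), span {(n : 𝓞 K), x} ∈ (Ideal (𝓞 K))⁰ :=
    fun n hn x => span_pair_natCast_mem_nonZeroDivisors (K := K) hn x
  have hPg : span {(5 : 𝓞 K), t - 3} ∈ (Ideal (𝓞 K))⁰ := P5_mem_nonZeroDivisors_eighteen hθ
  have hpartner : ∀ (Q : Ideal (𝓞 K)) (hQ0 : Q ∈ (Ideal (𝓞 K))⁰) (x : 𝓞 K), x ≠ 0 →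
      span {(5 : 𝓞 K), t - 3} * Q = span {x} → ClassGroup.mk0 ⟨Q, hQ0⟩ ∈ H := by
    intro Q hQ0 x hx hQ
    rw [hinv Q _ hQ0 hPg x hx (by rw [mul_comm]; exact hQ)]
    exact H.inv_mem hcgH
  -- second-generation partners: `R Q = (x)` with `[R] = [𝔭]⁻¹` gives `[Q] = [𝔭]`
  have hpartner2 : ∀ (R Q : Ideal (𝓞 K)) (hR0 : R ∈ (Ideal (𝓞 K))⁰) (hQ0 : Q ∈ (Ideal (𝓞 K))⁰)
      (x : 𝓞 K), x ≠ 0 → R * Q = span {x} → ClassGroup.mk0 ⟨R, hR0⟩ = cg⁻¹ →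
        ClassGroup.mk0 ⟨Q, hQ0⟩ ∈ H := by
    intro R Q hR0 hQ0 x hx hRQ hR
    rw [hinv Q R hQ0 hR0 x hx (by rw [mul_comm]; exact hRQ), hR, inv_inv]
    exact hcgH
  have hP61 : span {(61 : 𝓞 K), t - 18} ∈ (Ideal (𝓞 K))⁰ := by
    have h := hnz 61 (by norm_num) (t - 18)
    simp only [Nat.cast_ofNat] at h
    exact h
  have h61cls : ClassGroup.mk0 ⟨span {(61 : 𝓞 K), t - 18}, hP61⟩ = cg⁻¹ :=
    hinv _ _ hP61 hPg _ hne6 (by rw [mul_comm]; exact P5_mul_P61_eighteen hθ)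
  -- Minkowski: `⌊M_K⌋ ≤ 67`
  have hd : ((|NumberField.discr K| : ℤ) : ℝ) ≤ (56137 : ℕ) := by
    rw [discr_eq_eighteen hθ h3]
    norm_num
  have hfloor := floor_minkowskiBound_le_cubic h3 hd (s := 237) (U := 67) (by norm_num)
    (by norm_num) (by norm_num)
  have htop : H = ⊤ := by
    refine classGroup_subgroup_eq_top_of_primesOver H hfloor fun p hp hprime P hP0 hP hle => ?_
    have hpU : p ≤ 67 := (Finset.mem_Icc.mp hp).2
    have h1p : 1 ≤ p := (Finset.mem_Icc.mp hp).1
    interval_cases p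
    · exact absurd hprime (by decide)
    · exact hprinc P hP0 _ (eq_span_of_inert_eighteen hθ h3 (by norm_num) hP)
    · exact hprinc P hP0 _ (eq_span_of_inert_eighteen hθ h3 (by norm_num) hP)
    · exact absurd hprime (by decide)
    · -- `p = 5`
      rcases eq_P5_or_eq_Q5_eighteen hθ h3 hP with h | h <;> subst h
      · exact hcgH
      · exact hpartner _ hP0 5 (by norm_num) (P5_mul_Q5_eighteen hθ)
    · exact absurd hprime (by decide)
    · exact hprinc P hP0 _ (eq_span_of_inert_eighteen hθ h3 (by norm_num) hP)
    · exact absurd hprime (by decide)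
    · exact absurd hprime (by decide)
    · exact absurd hprime (by decide)
    · exact hprinc P hP0 _ (eq_span_of_inert_eighteen hθ h3 (by norm_num) hP)
    · exact absurd hprime (by decide)
    · exact hprinc P hP0 _ (eq_span_of_inert_eighteen hθ h3 (by norm_num) hP)
    · exact absurd hprime (by decide)
    · exact absurd hprime (by decide)
    · exact absurd hprime (by decide)
    · -- `p = 17`
      have h := eq_span_pair_of_unique_root_eighteen hθ h3 (Or.inl ⟨rfl, rfl⟩) hP hle
      simp only [Nat.cast_ofNat, Int.cast_ofNat] at h
      subst h
      exact hpartner _ hP0 _ hne2 (P5_mul_P17_eighteen hθ)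
    · exact absurd hprime (by decide)
    · exact hprinc P hP0 _ (eq_span_of_inert_eighteen hθ h3 (by norm_num) hP)
    · exact absurd hprime (by decide)
    · exact absurd hprime (by decide)
    · exact absurd hprime (by decide)
    · -- `p = 23`
      have h := eq_span_pair_of_unique_root_eighteen hθ h3 (Or.inr (Or.inl ⟨rfl, rfl⟩)) hP hle
      simp only [Nat.cast_ofNat, Int.cast_ofNat] at h
      subst h
      exact hpartner _ hP0 _ hne3 (P5_mul_P23_eighteen hθ)
    · exact absurd hprime (by decide)
    · exact absurd hprime (by decide)
    · exact absurd hprime (by decide)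
    · exact absurd hprime (by decide)
    · exact absurd hprime (by decide)
    · exact hprinc P hP0 _ (eq_span_of_inert_eighteen hθ h3 (by norm_num) hP)
    · exact absurd hprime (by decide)
    · -- `p = 31`
      have h := eq_span_pair_of_unique_root_eighteen hθ h3 (Or.inr (Or.inr (Or.inl ⟨rfl, rfl⟩))) hP hle
      simp only [Nat.cast_ofNat, Int.cast_ofNat] at h
      subst h
      exact hprinc _ hP0 _ (P31_eq_eighteen hθ)
    · exact absurd hprime (by decide)
    · exact absurd hprime (by decide)
    · exact absurd hprime (by decide)
    · exact absurd hprime (by decide)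
    · exact absurd hprime (by decide)
    · -- `p = 37`
      have h := eq_span_pair_of_unique_root_eighteen hθ h3 (Or.inr (Or.inr (Or.inr (Or.inl ⟨rfl, rfl⟩)))) hP hle
      simp only [Nat.cast_ofNat, Int.cast_ofNat] at h
      subst h
      exact hprinc _ hP0 _ (P37_eq_eighteen hθ)
    · exact absurd hprime (by decide)
    · exact absurd hprime (by decide)
    · exact absurd hprime (by decide)
    · exact hprinc P hP0 _ (eq_span_of_inert_eighteen hθ h3 (by norm_num) hP)
    · exact absurd hprime (by decide)
    · -- `p = 43`
      have h := eq_span_pair_of_unique_root_eighteen hθ h3 (Or.inr (Or.inr (Or.inr (Or.inr (Or.inl ⟨rfl, rfl⟩))))) hP hle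
      simp only [Nat.cast_ofNat, Int.cast_ofNat] at h
      subst h
      exact hpartner _ hP0 _ hne4 (P5_mul_P43_eighteen hθ)
    · exact absurd hprime (by decide)
    · exact absurd hprime (by decide)
    · exact absurd hprime (by decide)
    · -- `p = 47`
      have h := eq_span_pair_of_unique_root_eighteen hθ h3 (Or.inr (Or.inr (Or.inr (Or.inr (Or.inr (Or.inl ⟨rfl, rfl⟩)))))) hP hle
      simp only [Nat.cast_ofNat, Int.cast_ofNat] at h
      subst h
      exact hpartner _ hP0 _ hne5 (P5_mul_P47_eighteen hθ)
    · exact absurd hprime (by decide)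
    · exact absurd hprime (by decide)
    · exact absurd hprime (by decide)
    · exact absurd hprime (by decide)
    · exact absurd hprime (by decide)
    · exact hprinc P hP0 _ (eq_span_of_inert_eighteen hθ h3 (by norm_num) hP)
    · exact absurd hprime (by decide)
    · exact absurd hprime (by decide)
    · exact absurd hprime (by decide)
    · exact absurd hprime (by decide)
    · exact absurd hprime (by decide)
    · exact hprinc P hP0 _ (eq_span_of_inert_eighteen hθ h3 (by norm_num) hP)
    · exact absurd hprime (by decide)
    · -- `p = 61`
      have h := eq_span_pair_of_unique_root_eighteen hθ h3 (Or.inr (Or.inr (Or.inr (Or.inr (Or.inr (Or.inr (Or.inl ⟨rfl, rfl⟩))))))) hP hle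
      simp only [Nat.cast_ofNat, Int.cast_ofNat] at h
      subst h
      exact hpartner _ hP0 _ hne6 (P5_mul_P61_eighteen hθ)
    · exact absurd hprime (by decide)
    · exact absurd hprime (by decide)
    · exact absurd hprime (by decide)
    · exact absurd hprime (by decide)
    · exact absurd hprime (by decide)
    · -- `p = 67`
      have h := eq_span_pair_of_unique_root_eighteen hθ h3 (Or.inr (Or.inr (Or.inr (Or.inr (Or.inr (Or.inr (Or.inr (⟨rfl, rfl⟩)))))))) hP hle
      simp only [Nat.cast_ofNat, Int.cast_ofNat] at h
      subst h
      exact hpartner2 _ _ hP61 hP0 _ hne7 (P61_mul_P67_eighteen hθ) h61cls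
  have hC : C ∈ H := by rw [htop]; exact Subgroup.mem_top C
  obtain ⟨k, rfl⟩ := Subgroup.mem_zpowers_iff.mp hC
  have h2 : cg ^ (2 : ℤ) = 1 := by rw [zpow_two]; exact hsq
  obtain ⟨j, rfl | rfl⟩ := Int.even_or_odd' k
  · left
    rw [zpow_mul, h2, one_zpow]
  · right
    rw [zpow_add, zpow_mul, h2, one_zpow, one_mul, zpow_one]


end Field


/-! ### The ideal classes of `ℤ[X]/(f₁₈)` and Gompf's conjecture for the traces `18` and `-13` -/

section Matrices

/-- **The ideal classes of `ℤ[Θ₁₈] = ℤ[X]/(f₁₈)`**: every non-zero ideal is in the class of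
`⟨Θ - 1, 1⟩` or of `⟨Θ - 3, 5⟩` (the representatives `(1, 1, 18)`, `(3, 5, 18)` cover `C(ℤ[Θ₁₈])`). [cite: KimYamada2023, §6.1 (proof of Thm. B)] -/
theorem ideal_class_adjoinRoot_eighteen (J : Ideal (AdjoinRoot (csPoly 18))) (hJ : J ≠ ⊥) :
    ∃ x y : AdjoinRoot (csPoly 18), x ≠ 0 ∧ y ≠ 0 ∧
      (span {x} * J = span {y} * csIdeal 1 1 18 ∨ span {x} * J = span {y} * csIdeal 3 5 18) := by
  classical
  set θ' := AdjoinRoot.root (csPolyQ 18) with hθ'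
  have hθ : aeval θ' (csPoly 18) = 0 := aeval_root_csPoly 18
  have h3 : finrank ℚ (CSField 18) = 3 := finrank_CSField 18
  obtain ⟨e, he⟩ := exists_ringEquiv_adjoinRoot_of_sq hθ h3 csDisc_eighteen_sq
  set I : Ideal (𝓞 (CSField 18)) := J.map e with hI
  have hIJ : I.map (e.symm : 𝓞 (CSField 18) →+* AdjoinRoot (csPoly 18)) = J := by
    rw [hI]
    exact Ideal.map_of_equiv e (I := J)
  have hI0 : I ≠ ⊥ := by
    intro h0
    apply hJ
    rw [← hIJ, h0, Ideal.map_bot]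
  have hImem : I ∈ (Ideal (𝓞 (CSField 18)))⁰ := mem_nonZeroDivisors_iff_ne_zero.mpr hI0
  have hsymm : ∀ x, (e.symm : 𝓞 (CSField 18) →+* AdjoinRoot (csPoly 18)) (e x) = x :=
    fun x => e.symm_apply_apply x
  have hPg : (span {(5 : 𝓞 (CSField 18)), thetaInt hθ - 3}).map
      (e.symm : 𝓞 (CSField 18) →+* AdjoinRoot (csPoly 18)) = csIdeal 3 5 18 := by
    rw [Ideal.map_span, Set.image_insert_eq, Set.image_singleton, map_sub, ← he, hsymm, map_ofNat,
      map_ofNat, csIdeal, Set.pair_comm]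
    simp
  rcases classGroup_mem_pair_eighteen hθ h3 (ClassGroup.mk0 ⟨I, hImem⟩) with h1 | hg
  · obtain ⟨z, hz⟩ := ((ClassGroup.mk0_eq_one_iff hImem).mp h1).principal
    have hz' : I = span {z} := by rw [hz, submodule_span_eq]
    have hz0 : z ≠ 0 := by
      rintro rfl
      apply hI0
      rw [hz', Ideal.span_singleton_eq_bot]
    refine ⟨1, (e.symm : 𝓞 (CSField 18) →+* AdjoinRoot (csPoly 18)) z, one_ne_zero,
      (map_ne_zero_iff _ e.symm.injective).mpr hz0, Or.inl ?_⟩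
    rw [Ideal.span_singleton_one, Ideal.top_mul, csIdeal_one_one, Ideal.mul_top, ← hIJ, hz',
      Ideal.map_span, Set.image_singleton]
  · obtain ⟨x, y, hx, hy, hxy⟩ := ClassGroup.mk0_eq_mk0_iff.mp hg
    refine ⟨(e.symm : 𝓞 (CSField 18) →+* AdjoinRoot (csPoly 18)) x,
      (e.symm : 𝓞 (CSField 18) →+* AdjoinRoot (csPoly 18)) y,
      (map_ne_zero_iff _ e.symm.injective).mpr hx, (map_ne_zero_iff _ e.symm.injective).mpr hy,
      Or.inr ?_⟩
    have h := congrArg (Ideal.map (e.symm : 𝓞 (CSField 18) →+* AdjoinRoot (csPoly 18))) hxy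
    simp only [Ideal.map_mul, Ideal.map_span, Set.image_singleton] at h
    rw [hIJ] at h
    rw [h, ← hPg, Ideal.map_span]

/-- `5 ∣ f₁₈(3) = -145`: `(3, 5, 18) ∈ 𝒞𝒮`. [cite: KimYamada2023, §6.1 (proof of Thm. B)] -/
theorem rep_dvd_eval_csPoly_eighteen : (5 : ℤ) ∣ (csPoly 18).eval 3 := by
  rw [eval_csPoly]; norm_num

/-- **Every Cappell–Shaneson matrix of trace `18` is similar to `X_{1,1,18} = A₁₆` or to
`X_{3,5,18}`** (Prop. 2.14). [cite: KimYamada2023, §6.1 (proof of Thm. B) and Prop. 2.14] -/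
theorem isConj_standardCSMatrix_of_trace_eq_eighteen (A : SL(3, ℤ))
    (hdet : ((A : Matrix (Fin 3) (Fin 3) ℤ) - 1).det = 1)
    (htr : Matrix.trace (A : Matrix (Fin 3) (Fin 3) ℤ) = 18) :
    IsConj A (standardCSMatrix 1 1 18 (one_dvd _)) ∨
      IsConj A (standardCSMatrix 3 5 18 rep_dvd_eval_csPoly_eighteen) := by
  have hcover : ∀ J : Ideal (AdjoinRoot (csPoly 18)), J ≠ ⊥ →
      ∃ (c d : ℤ) (_ : d ∣ (csPoly 18).eval c) (x y : AdjoinRoot (csPoly 18)),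
        x ≠ 0 ∧ y ≠ 0 ∧ Ideal.span {x} * J = Ideal.span {y} * csIdeal c d 18 ∧
          ((c = 1 ∧ d = 1) ∨ (c = 3 ∧ d = 5)) := by
    intro J hJ
    obtain ⟨x, y, hx, hy, hxy⟩ := ideal_class_adjoinRoot_eighteen J hJ
    rcases hxy with h1 | hg
    · exact ⟨1, 1, one_dvd _, x, y, hx, hy, h1, Or.inl ⟨rfl, rfl⟩⟩
    · exact ⟨3, 5, rep_dvd_eval_csPoly_eighteen, x, y, hx, hy, hg, Or.inr ⟨rfl, rfl⟩⟩
  obtain ⟨c, d, h, hconj, hcd⟩ := exists_isConj_standardCSMatrix_of_cover _ hcover A hdet htr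
  rcases hcd with ⟨rfl, rfl⟩ | ⟨rfl, rfl⟩
  · exact Or.inl hconj
  · exact Or.inr hconj

/-- **Kim–Yamada 2023, Theorem B for the trace `18`, PROVED**: the non-trivial class `(3, 5, 18)`
moves by two Gompf moves (`18 - 2·5 = 8`) to the trace `8`, where Gompf's conjecture holds. [cite: KimYamada2023, Thm. B and §6.1] -/
theorem gompfConjectureForTrace_eighteen : GompfConjectureForTrace 18 := by
  intro A hdet htr
  rcases isConj_standardCSMatrix_of_trace_eq_eighteen A hdet htr with h1 | hg
  · exact (GompfEquiv.of_isConj h1).trans (gompfEquiv_standardCSMatrix_one_one 16 (one_dvd _))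
  · exact (GompfEquiv.of_isConj hg).trans
      (gompfEquiv_standardCSMatrix_akbulutKirbyMatrix_of_modEq
        (gompfConjectureForTrace_of_mem_Icc (by norm_num)) rep_dvd_eval_csPoly_eighteen
        (show (18 : ℤ) ≡ 8 [ZMOD 5] by decide))

/-- **Theorem B for the trace `-13`** (`= 5 - 18`), by Theorem A. [cite: KimYamada2023, Thm. A and Thm. B] -/
theorem gompfConjectureForTrace_neg_thirteen : GompfConjectureForTrace (-13) := by
  have h := gompfConjectureForTrace_of_five_sub gompfConjectureForTrace_eighteen
  norm_num at h
  exact h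

end Matrices


end Literature.Topology.FourManifolds

end
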